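import Summits.Langlands.Langlands.Theses.DegenerateLimits
import Literature.NumberTheory.Automorphic.BuzzardGeeArithmetic
import Literature.NumberTheory.Automorphic.WeaklyRegularGaloisRep

/-!
# Birth skeleton (BC3) for crux stmt-Langlands-2631
`Summit.Langlands.Langlands.Theses.DegenerateLimits.SatakeFieldFinite` — line `birth`

Route `route-Langlands-DegenerateLimits` (crux, rank 4, "hidden arithmeticity"). The crux: for a CM
field `F`, a cuspidal `π` on `GL_n(𝔸_F)` with (i) an L-algebraic infinity type `T` having, at some
embedding, an exponent of ODD multiplicity and (ii) conjugate self-duality up to `|det|^m` at the Satake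
level, and for EVERY prime `ℓ` and EVERY field isomorphism `ι : ℚ̄_ℓ ≃ ℂ`, there are a subfield
`E ⊆ ℚ̄_ℓ` finite over `ℚ_ℓ` and a finite set `S` of places such that every coefficient of the predicted
arithmetic-Frobenius polynomial `arithFrobPolyOfSatake ι q_v 1 α = ∏ (X - ι⁻¹(α_j⁻¹))` lies in `E`
for `v ∉ S`. It is necessary for the route's thesis X (a continuous `ρ : Γ_F → GL_n(ℚ̄_ℓ)` has a model
over a finite `E/ℚ_ℓ`, Baire) and feeds the interpolation lemma `GaloisRepOfLadicLimit`.

The line `birth` cuts the crux along the one structural fact of the sector — WHERE Galois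
representations are known — and, where they are not, transports the crux to its `ι`-free form:

* `stub_weaklyRegularGalois` — **the weakly regular half has Galois representations** (L; known in
  print: Fakhruddin–Pilloni Thm. 9.10 with Thm. 9.1, vendored as the named facts
  `FakhruddinPilloni2021_galoisRep_of_weaklyRegular_normTwist` / `…_odd` / `…_odd_of_weaklyRegular`;
  in-tree work = the L/C half-twist (`InfinityType.isCAlgebraic_iff_isLAlgebraic_twist`,
  `IsWeaklyRegular.twist`), Satake-level polarisation (ii) ⇒ `IsEssConjSelfDual π ‖·‖^m` (strong
  multiplicity one rigidity), and `arithFrobPolyOfSatake ι q n α' = arithFrobPolyOfSatake ι q 1 α` for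
  the twist, as in the evidence file `RegularSatakeA_of_HLTT.lean` of item `RegularSatakeA`). If `T` is
  moreover WEAKLY REGULAR (every exponent multiplicity `≤ 2`), then for all `ℓ`, `ι` some
  `ρ : Γ_F → GL_n(ℚ̄_ℓ)` is Satake–Frobenius compatible with `π` at almost all `v`.
* `stub_fieldOfGaloisRep` — **an a.e.-compatible `ρ` pins the `ι`-transported Satake field inside a
  finite extension of `ℚ_ℓ`** (M; provable now). Any automorphic `π` of `GL_n(𝔸_F)` (any number field)
  and any `ρ : Γ_F → GL_n(ℚ̄_ℓ)` with `SatakeFrobCompatibleAt ι π ρ v` for almost all `v` give `E`, `S`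
  as in the crux: `ρ` has a model over a finite `E/ℚ_ℓ` (`exists_hasQlModel_holds`, Baire), a Frobenius
  exists at every `v` (`primesAbove_nonempty`, `exists_isArithFrobAt_of_mem_primesAbove_holds`), its
  characteristic polynomial is defined over `E` and is invariant under the change of frame, and Satake
  parameters are unique (`hasSatakeParamAt_unique_holds`).
* `stub_lArithmeticOfDegenerate` — **Buzzard–Gee L-arithmeticity in the DEGENERATE sector** (XL;
  OPEN — the crux's own open content, `ι`-free). If `T` is NOT weakly regular (some exponent has
  multiplicity `≥ 3`: the descents of `π` to unitary groups are degenerate limits of discrete series or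
  non-LDS tempered, no cohomological realisation is known), then `π` is L-arithmetic
  (`AutomorphicRepData.IsLArithmetic`: one number field `E ⊆ ℂ` contains the coefficients of
  `∏ (X - α_j)` for almost all `v`) — the direction "L-algebraic ⇒ L-arithmetic" of Buzzard–Gee
  Conj. 3.1.5 (`lArithmetic_of_lAlgebraic`) for these `π`; a special case of crux `LArithmeticity`
  (stmt-Langlands-17409) of route `HeckeFieldDeRham`. TRANSFER `C⁺`: stronger than the crux in this
  sector and `ι`-FREE — the wild field isomorphism disappears, and what is exposed is a rational
  structure / bounded-degree problem for Hecke eigenvalues (Clozel Thm. 3.13, Blasius–Harris–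
  Ramakrishnan, Shin–Templier are the tools that exist one sector up).
* `stub_transport` — **L-arithmetic ⇒ the crux's conclusion for every `ℓ`, `ι`** (M; provable now, pure
  algebra): `∏ (X - a) ∈ E[X]` ⇒ `∏ (X - a⁻¹) ∈ E[X]` (reciprocal polynomial; `a ≠ 0` by
  `hasSatakeParamAt_ne_zero_holds`, or directly), so the coefficients of `arithFrobPolyOfSatake ι q 1 α`
  lie in `ι⁻¹(E)`, and `ℚ_ℓ(ι⁻¹ E) = ℚ_ℓ(ι⁻¹ b₁, …, ι⁻¹ b_d)` (`b` a `ℚ`-basis of `E`) is finite over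
  `ℚ_ℓ` because `ℚ̄_ℓ/ℚ_ℓ` is algebraic (`IntermediateField.finiteDimensional_adjoin`).
* `SatakeFieldFinite_of` — the composition, kernel-checked, concluding the route decl BY NAME: take
  `T` from (i); if `T` is weakly regular, `stub_weaklyRegularGalois` then `stub_fieldOfGaloisRep`;
  otherwise `stub_lArithmeticOfDegenerate` then `stub_transport`.

Disproof used: none on file (`ledger crux ls stmt-Langlands-2631`: no workfiles, no `Disproof.lean`,
no `Negative/` lemmas, no ideas, 2026-08-17). Negatives index (`ledger negatives --problem Langlands`,
3 entries: `SplitPrimeInduction.Deinduction`, `OrdinaryPrimeTransport.RankinSelbergPoleCount`,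
`K3KugaSatakeDescent.SerreTypeAnchor`): none is a stub here or trivially equivalent to one; the
`n = 0` degeneracy behind the second cannot bite (hypothesis (i) is unsatisfiable for `n = 0`, and the
two unconditional stubs are true for `n = 0`).

Shape (for `ledger skeleton check`): stubs `theorem stub_<name> : <signature> := by sorry` stated over
tree declarations only (fully qualified, as in the route file); `_Goal.stub_<name> : Prop :=
type_of% @stub_<name>` names each statement; `SatakeFieldFinite_of (hW : _Goal.stub_weaklyRegularGalois)
(hG : _Goal.stub_fieldOfGaloisRep) (hD : _Goal.stub_lArithmeticOfDegenerate) (hT : _Goal.stub_transport) :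
SatakeFieldFinite` is proved without `sorry`.
-/

set_option linter.dupNamespace false
set_option linter.unusedVariables false

noncomputable section

namespace Summit.Langlands.Langlands.Cruxes.SatakeFieldFinite.Birth

-- `Classical`: the place subtypes indexing `mixedSpace F` are `Fintype` classically
-- (`NormedCommRing (mixedSpace F)`, needed to write `AutomorphyDatum.gl n F hcpt`), as in the route file.
open scoped Classical
open Summit.Langlands.Langlands.Theses.DegenerateLimits
open Literature.NumberTheory.GaloisRepresentations Literature.NumberTheory.Automorphic
open NumberField IsDedekindDomain

/-! ## 1. The four stubs -/

/-- **STUB 1 — Galois representations in the weakly regular half of the sector (L; known in print).**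
`F` CM, `π` cuspidal on `GL_n(𝔸_F)` with an infinity type `T` that is L-algebraic, WEAKLY REGULAR and has
at some embedding an exponent of odd multiplicity, `π` conjugate self-dual up to `|det|^m` at the Satake
level (hypothesis (ii) of the crux, verbatim): then for every `ℓ` and `ι : ℚ̄_ℓ ≃ ℂ` there is a continuous
`ρ : Γ_F → GL_n(ℚ̄_ℓ)` with `SatakeFrobCompatibleAt ι π ρ v` at almost all `v`. Printed content:
Fakhruddin–Pilloni Thm. 9.10 (with Thm. 9.1 / 9.7 for oddness, which the odd-multiplicity exponent forces:
`InfinityType.not_isEvenlyPaired_of_odd_count`), vendored as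
`FakhruddinPilloni2021_galoisRep_of_weaklyRegular_normTwist`; in-tree work: pass to the C-algebraic twist
`π ⊗ |det|^{(n-1)/2}` (`InfinityType.isCAlgebraic_iff_isLAlgebraic_twist`, `IsWeaklyRegular.twist`),
upgrade the Satake-level polarisation to `IsEssConjSelfDual π ‖·‖^m` (strong multiplicity one for the
cuspidal `π^c`, `π^∨ ⊗ ‖det‖^m`), read `arithFrobPolyOfSatake ι q_v n α'` of the twist as
`arithFrobPolyOfSatake ι q_v 1 α`, and discard the finitely many `v ∣ ℓ` and ramified `v`
(`hasSatakeParamAt_cofinite_holds`).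
[cite: FakhruddinPilloni2021, Thm. 9.10 and Thm. 9.1] [cite: JacquetShalika1981, §4 (strong multiplicity one)] -/
theorem stub_weaklyRegularGalois :
    ∀ (F : Type) [Field F] [NumberField F] [NumberField.IsCMField F] (n : ℕ)
      (hcpt : Literature.NumberTheory.Automorphic.isCompact_glFiniteIntegralLevel n F)
      (π : Literature.NumberTheory.Automorphic.CuspidalAutomorphicRepData n F hcpt)
      (T : Literature.NumberTheory.Automorphic.InfinityType F n),
      π.1.HasInfinityType T → T.IsLAlgebraic → T.IsWeaklyRegular →
      (∃ (σ : F →+* ℂ) (a : ℂ),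
        Odd (((T σ).map Literature.NumberTheory.Automorphic.ArchWeight.a).count a)) →
      (∃ m : ℤ, ∀ᶠ v : IsDedekindDomain.HeightOneSpectrum (NumberField.RingOfIntegers F) in
        Filter.cofinite, ∀ α β : Multiset ℂ, π.1.HasSatakeParamAt v α →
          π.1.HasSatakeParamAt (IsDedekindDomain.HeightOneSpectrum.equivOfRingEquiv
            (NumberField.IsCMField.ringOfIntegersComplexConj F).toRingEquiv v) β →
            β = α.map (fun a ↦ a⁻¹ * (v.residueCard : ℂ) ^ (-m))) →
      ∀ (ℓ : ℕ) [Fact ℓ.Prime] (ι : PadicAlgCl ℓ ≃+* ℂ),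
        ∃ ρ : Literature.NumberTheory.GaloisRepresentations.FramedGaloisRep F (PadicAlgCl ℓ) n,
          ∀ᶠ v : IsDedekindDomain.HeightOneSpectrum (NumberField.RingOfIntegers F) in Filter.cofinite,
            Summit.Langlands.SatakeFrobCompatibleAt ι π.1 ρ v := by
  sorry

/-- **STUB 2 — an almost-everywhere compatible `ρ` puts the `ι`-transported Satake field in a finite
extension of `ℚ_ℓ` (M; provable now).** For any number field `F`, any automorphic `π` of `GL_n(𝔸_F)`
(Borel–Jacquet datum, not necessarily cuspidal), any `ℓ`, `ι` and any `ρ : Γ_F → GL_n(ℚ̄_ℓ)` with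
`SatakeFrobCompatibleAt ι π ρ v` for almost all `v`: there are `E ⊆ ℚ̄_ℓ` finite over `ℚ_ℓ` and a finite
`S` with every coefficient of `arithFrobPolyOfSatake ι q_v 1 α` in `E` for `v ∉ S` and every Satake
parameter `α` of `π` at `v`. Proof in tree-sized pieces: a model `ρ = P · rE · P⁻¹` over a finite `E/ℚ_ℓ`
(`exists_hasQlModel_holds`, Baire); at `v ∉ S :=` the exceptional set of the compatibility, pick `𝔓 ∣ v`
and an arithmetic Frobenius `σ` (`HeightOneSpectrum.primesAbove_nonempty`,
`exists_isArithFrobAt_of_mem_primesAbove_holds`); `charpoly (ρ σ) = (charpoly (rE σ)).map (E → ℚ̄_ℓ)`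
has coefficients in `E` and equals `arithFrobPolyOfSatake ι q_v 1 α₀` for the compatible `α₀`, and
`α = α₀` (`hasSatakeParamAt_unique_holds`).
[cite: BuzzardGeeLMS2014, footnote to Conj. 3.2.1 (models over finite E)] [cite: Skinner2009, §2] -/
theorem stub_fieldOfGaloisRep :
    ∀ (F : Type) [Field F] [NumberField F] (n : ℕ)
      (hcpt : Literature.NumberTheory.Automorphic.isCompact_glFiniteIntegralLevel n F)
      (π : Literature.NumberTheory.Automorphic.AutomorphicRepData
        (Literature.NumberTheory.Automorphic.AutomorphyDatum.gl n F hcpt))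
      (ℓ : ℕ) [Fact ℓ.Prime] (ι : PadicAlgCl ℓ ≃+* ℂ)
      (ρ : Literature.NumberTheory.GaloisRepresentations.FramedGaloisRep F (PadicAlgCl ℓ) n),
      (∀ᶠ v : IsDedekindDomain.HeightOneSpectrum (NumberField.RingOfIntegers F) in Filter.cofinite,
        Summit.Langlands.SatakeFrobCompatibleAt ι π ρ v) →
      ∃ (E : IntermediateField ℚ_[ℓ] (PadicAlgCl ℓ))
        (S : Set (IsDedekindDomain.HeightOneSpectrum (NumberField.RingOfIntegers F))),
        FiniteDimensional ℚ_[ℓ] E ∧ S.Finite ∧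
          ∀ v ∉ S, ∀ α : Multiset ℂ, π.HasSatakeParamAt v α → ∀ k : ℕ,
            (Literature.NumberTheory.Automorphic.arithFrobPolyOfSatake ι v.residueCard 1 α).coeff k
              ∈ E := by
  sorry

/-- **STUB 3 — L-arithmeticity in the degenerate sector (XL; OPEN: Buzzard–Gee Conj. 3.1.5 for these `π`).**
`F` CM, `π` cuspidal on `GL_n(𝔸_F)` with an L-algebraic infinity type `T` having at some embedding an
exponent of odd multiplicity and which is NOT weakly regular (so some exponent has multiplicity `≥ 3`:
the descents of `π` to unitary groups are (partially) degenerate limits of discrete series or non-LDS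
tempered — no Betti or classical coherent realisation, Goldring 2016 §4.4.1–4.4.2), `π` conjugate
self-dual up to `|det|^m` at the Satake level: then `π` is L-ARITHMETIC (`IsLArithmetic`, Buzzard–Gee
Def. 3.1.3: one number field `E ⊆ ℂ` contains the coefficients of `∏_{a ∈ α} (X - a)` for every Satake
parameter `α` at all but finitely many `v`). The `ι`-free strengthening (transfer `C⁺`) of the crux in
this sector; the named conjecture `lArithmetic_of_lAlgebraic` restricted to the sector; a special case of
crux `HeckeFieldDeRham.LArithmeticity` (stmt-Langlands-17409). Known one sector up by rational structures
on cohomology (Clozel Thm. 3.13, regular; Blasius–Harris–Ramakrishnan, non-degenerate limits of discrete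
series in coherent cohomology); nothing is known here — not even algebraicity of one Hecke eigenvalue.
[cite: BuzzardGeeLMS2014, Def. 3.1.3 and Conj. 3.1.5] [cite: Clozel1990, Thm. 3.13]
[cite: BlasiusHarrisRamakrishnan1994, Introduction] [cite: Goldring2016, §4.4.1–4.4.2] -/
theorem stub_lArithmeticOfDegenerate :
    ∀ (F : Type) [Field F] [NumberField F] [NumberField.IsCMField F] (n : ℕ)
      (hcpt : Literature.NumberTheory.Automorphic.isCompact_glFiniteIntegralLevel n F)
      (π : Literature.NumberTheory.Automorphic.CuspidalAutomorphicRepData n F hcpt)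
      (T : Literature.NumberTheory.Automorphic.InfinityType F n),
      π.1.HasInfinityType T → T.IsLAlgebraic → ¬ T.IsWeaklyRegular →
      (∃ (σ : F →+* ℂ) (a : ℂ),
        Odd (((T σ).map Literature.NumberTheory.Automorphic.ArchWeight.a).count a)) →
      (∃ m : ℤ, ∀ᶠ v : IsDedekindDomain.HeightOneSpectrum (NumberField.RingOfIntegers F) in
        Filter.cofinite, ∀ α β : Multiset ℂ, π.1.HasSatakeParamAt v α →
          π.1.HasSatakeParamAt (IsDedekindDomain.HeightOneSpectrum.equivOfRingEquiv
            (NumberField.IsCMField.ringOfIntegersComplexConj F).toRingEquiv v) β →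
            β = α.map (fun a ↦ a⁻¹ * (v.residueCard : ℂ) ^ (-m))) →
      π.1.IsLArithmetic := by
  sorry

/-- **STUB 4 — transport: L-arithmetic ⇒ the `ι`-transported Satake field is finite over `ℚ_ℓ`, for
every `ℓ`, `ι` (M; provable now, pure algebra).** For any number field `F` and automorphic `π` of
`GL_n(𝔸_F)`: if `π` is L-arithmetic (number field `E ⊆ ℂ` containing the coefficients of `∏ (X - a)`,
`a ∈ α`, for almost all `v`), then for every `ℓ`, `ι` there are `E' ⊆ ℚ̄_ℓ` finite over `ℚ_ℓ` and a
finite `S` with all coefficients of `arithFrobPolyOfSatake ι q_v 1 α = ∏ (X - ι⁻¹(a⁻¹))` in `E'` for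
`v ∉ S`. Pieces: `∏ (X - a⁻¹) ∈ E[X]` (reciprocal polynomial: `e_k(α⁻¹) = e_{n-k}(α) / e_n(α)` with
`e_n(α) = ∏ a ≠ 0` by `hasSatakeParamAt_ne_zero_holds`; or split off the zero roots), hence the
coefficients of `arithFrobPolyOfSatake ι q_v 1 α` (`arithFrobPolyOfSatake_one`: the image of
`∏ (X - C a⁻¹)` under `ι.symm`) lie in `ι⁻¹(E)`; and `E' := ℚ_ℓ(ι⁻¹ b₁, …, ι⁻¹ b_d)` for a `ℚ`-basis
`b` of `E` contains `ι⁻¹(E)` and is finite over `ℚ_ℓ` since every element of `ℚ̄_ℓ` is algebraic over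
`ℚ_ℓ` (`IntermediateField.finiteDimensional_adjoin`). Only finite generation of `E` over `ℚ` is used.
[cite: BuzzardGeeLMS2014, §3.1 (discussion after Conj. 3.1.6)] -/
theorem stub_transport :
    ∀ (F : Type) [Field F] [NumberField F] (n : ℕ)
      (hcpt : Literature.NumberTheory.Automorphic.isCompact_glFiniteIntegralLevel n F)
      (π : Literature.NumberTheory.Automorphic.AutomorphicRepData
        (Literature.NumberTheory.Automorphic.AutomorphyDatum.gl n F hcpt)),
      π.IsLArithmetic →
      ∀ (ℓ : ℕ) [Fact ℓ.Prime] (ι : PadicAlgCl ℓ ≃+* ℂ),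
        ∃ (E : IntermediateField ℚ_[ℓ] (PadicAlgCl ℓ))
          (S : Set (IsDedekindDomain.HeightOneSpectrum (NumberField.RingOfIntegers F))),
          FiniteDimensional ℚ_[ℓ] E ∧ S.Finite ∧
            ∀ v ∉ S, ∀ α : Multiset ℂ, π.HasSatakeParamAt v α → ∀ k : ℕ,
              (Literature.NumberTheory.Automorphic.arithFrobPolyOfSatake ι v.residueCard 1 α).coeff k
                ∈ E := by
  sorry

/-! ## 2. The stub statements as named `Prop`s (literally their types) -/

namespace _Goal

/-- The statement of `stub_weaklyRegularGalois`, as a named `Prop` (literally its type). [folklore] -/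
def stub_weaklyRegularGalois : Prop :=
  type_of% @Summit.Langlands.Langlands.Cruxes.SatakeFieldFinite.Birth.stub_weaklyRegularGalois

/-- The statement of `stub_fieldOfGaloisRep`, as a named `Prop` (literally its type). [folklore] -/
def stub_fieldOfGaloisRep : Prop :=
  type_of% @Summit.Langlands.Langlands.Cruxes.SatakeFieldFinite.Birth.stub_fieldOfGaloisRep

/-- The statement of `stub_lArithmeticOfDegenerate`, as a named `Prop` (literally its type). [folklore] -/
def stub_lArithmeticOfDegenerate : Prop :=
  type_of% @Summit.Langlands.Langlands.Cruxes.SatakeFieldFinite.Birth.stub_lArithmeticOfDegenerate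

/-- The statement of `stub_transport`, as a named `Prop` (literally its type). [folklore] -/
def stub_transport : Prop :=
  type_of% @Summit.Langlands.Langlands.Cruxes.SatakeFieldFinite.Birth.stub_transport

end _Goal

/-! ## 3. The composition (kernel-checked, no `sorry`): split at weak regularity -/

/-- **`SatakeFieldFinite` from the four stubs.** Given `F`, `n`, `π`, hypotheses (i) and (ii), `ℓ`, `ι`:
take the infinity type `T` of (i). If `T` is weakly regular, `stub_weaklyRegularGalois` gives a `ρ`
compatible with `π` almost everywhere and `stub_fieldOfGaloisRep` the finite `E/ℚ_ℓ` and `S`; if not,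
`stub_lArithmeticOfDegenerate` makes `π` L-arithmetic and `stub_transport` transports the number field
along `ι⁻¹` into a finite extension of `ℚ_ℓ`. The hypotheses are, by name, the statements of the four
stubs; the conclusion is the route decl
`Summit.Langlands.Langlands.Theses.DegenerateLimits.SatakeFieldFinite`. [folklore] -/
theorem SatakeFieldFinite_of (hW : _Goal.stub_weaklyRegularGalois) (hG : _Goal.stub_fieldOfGaloisRep)
    (hD : _Goal.stub_lArithmeticOfDegenerate) (hT : _Goal.stub_transport) :
    Summit.Langlands.Langlands.Theses.DegenerateLimits.SatakeFieldFinite := by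
  -- the stub statements, as the Π-types they literally are
  have hWR : type_of% @stub_weaklyRegularGalois := hW
  have hGal : type_of% @stub_fieldOfGaloisRep := hG
  have hDeg : type_of% @stub_lArithmeticOfDegenerate := hD
  have hTr : type_of% @stub_transport := hT
  intro F _ _ _ n hcpt π hi hii ℓ _ ι
  -- the infinity type of hypothesis (i)
  obtain ⟨T, hπT, hTalg, hodd⟩ := hi
  by_cases hwr : T.IsWeaklyRegular
  · -- WEAKLY REGULAR: Galois representations exist (F–P), and a compatible `ρ` pins the field
    obtain ⟨ρ, hρ⟩ := hWR F n hcpt π T hπT hTalg hwr hodd hii ℓ ι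
    exact hGal F n hcpt π.1 ℓ ι ρ hρ
  · -- DEGENERATE: L-arithmeticity (open) transported along `ι⁻¹`
    exact hTr F n hcpt π.1 (hDeg F n hcpt π T hπT hTalg hwr hodd hii) ℓ ι

/-- By-name sanity check (an `example`, not a declaration of the file): the four stubs feed the
composition as they stand. -/
example : Summit.Langlands.Langlands.Theses.DegenerateLimits.SatakeFieldFinite :=
  SatakeFieldFinite_of stub_weaklyRegularGalois stub_fieldOfGaloisRep stub_lArithmeticOfDegenerate
    stub_transport

end Summit.Langlands.Langlands.Cruxes.SatakeFieldFinite.Birth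

end
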